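import Mathlib
import Summits.PneNP.PneNP.Theorems.SymmetryBudgetHamCompilesDefs

/-!
# `W_F(d) = Cspan F d`: stub `stub_spanRecursion` of line `kotzig-cutspan`

Route `PneNP/SymmetryBudget`, crux `Summit.PneNP.PneNP.Theses.SymmetryBudget.HamCompiles`
(stmt-PneNP-10637), line `kotzig-cutspan`, registered stub `stub_spanRecursion`: the `GF(2)`-span
`WF m x d` of the cut vectors `uF` of the path covers of `G[F]` (`F = freeSet m`) with rank margins
`d` equals the closed state `Cspan m x (freeSet m) d` of the span-valued Held–Karp (vertex-growth)
recursion `Cspan`/`Ospan` of `SymmetryBudgetHamCompilesDefs`.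

Proof (pure combinatorics of path covers; spans ignore order and multiplicity, masks are linear).
With the generating sets
`C(P, e) = {uF PF | PF covers G[P], margins e}` and
`O(P, v, i, e) = {uF PF | (p :: PF) covers G[P], p ends at v, rk (first p) = i, margins PF = e}`
we prove, by strong induction on `P` (erasing the end vertex `v` of the open path, resp. closing
the first path of a cover), the two halves of `Cspan P e = span C(P, e)`,
`Ospan P v i e = span O(P, v, i, e)` in binder form (no auxiliary definitions):
* `SpanRecursion.gen_mem`: every generator lies in the state (`P ⊆ F`, so that ranks are `< g`);
* `SpanRecursion.min_le`: every state lies in any subspace containing the generators.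
Ingredients: splitting a cover `(v, []) :: PF` / `(a, l ++ [v]) :: PF` of `P` into a cover of
`P.erase v` (`cover_single_cons`, `cover_concat_cons`), `uF (p :: PF) = mask ⊙ uF PF` (`uF_cons`)
and `fSlots (p :: PF) = fSlots PF + δ i + δ j` (`fSlots_cons`), and `rk u < g` on `F`
(`exists_fin_eq_rk`).
-/

-- `Summit.PneNP.PneNP.…` duplicates `PneNP` BY DESIGN (single-problem summit, D-0017).
set_option linter.dupNamespace false

noncomputable section

namespace Summit.PneNP.PneNP.Theorems.HamCompilesKC

open Literature.Computability.Complexity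
open Finset

namespace SpanRecursion

/-! ### Covers: splitting off a one-vertex path / the last vertex of the first path -/

section CoverLemmas

variable {V : Type*}

/-- The last vertex of a sequence extended by `b` is `b`. -/
theorem last_mk_concat (a : V) (l : List V) (b : V) : VSeq.last (a, l ++ [b]) = b := by
  show ((a :: l) ++ [b]).getLast _ = b
  exact List.getLast_append_singleton _

/-- A chain extended by one vertex. -/
theorem isChain_cons_append_singleton {R : V → V → Prop} (a : V) (l : List V) (b : V) :
    List.IsChain R (a :: l ++ [b]) ↔
      List.IsChain R (a :: l) ∧ R ((a :: l).getLast (List.cons_ne_nil _ _)) b := by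
  rw [List.isChain_append]
  simp [List.getLast?_eq_some_getLast]

variable [DecidableEq V] {G : SimpleGraph V}

/-- Only the empty family covers the empty set. -/
theorem cover_empty_eq_nil {PF : List (VSeq V)} (h : IsCoverOf G ∅ PF) : PF = [] := by
  obtain ⟨-, h2, -⟩ := h
  rw [List.toFinset_eq_empty_iff, List.flatten_eq_nil_iff] at h2
  cases PF with
  | nil => rfl
  | cons p PF => exact absurd (h2 p.verts (by simp)) (List.cons_ne_nil _ _)

/-- Every listed vertex of a cover of `S` lies in `S`. -/
theorem mem_of_cover {S : Finset V} {PF : List (VSeq V)} (h : IsCoverOf G S PF)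
    {p : VSeq V} (hp : p ∈ PF) {u : V} (hu : u ∈ p.verts) : u ∈ S := by
  rw [← h.2.1, List.mem_toFinset, List.mem_flatten]
  exact ⟨_, List.mem_map.2 ⟨p, hp, rfl⟩, hu⟩

/-- `insert v T = S` with `v ∉ T` means `v ∈ S` and `T = S.erase v`. -/
private theorem insert_helper {S T : Finset V} {v : V} :
    (v ∉ T ∧ insert v T = S) ↔ (v ∈ S ∧ T = S.erase v) := by
  constructor
  · rintro ⟨hv, rfl⟩
    exact ⟨Finset.mem_insert_self _ _, (Finset.erase_insert hv).symm⟩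
  · rintro ⟨hv, rfl⟩
    exact ⟨Finset.notMem_erase _ _, Finset.insert_erase hv⟩

/-- Splitting off a one-vertex path. -/
theorem cover_single_cons {S : Finset V} {v : V} {PF : List (VSeq V)} :
    IsCoverOf G S ((v, []) :: PF) ↔ v ∈ S ∧ IsCoverOf G (S.erase v) PF := by
  unfold IsCoverOf
  simp only [List.map_cons, List.flatten_cons, List.forall_mem_cons]
  simp only [VSeq.verts, List.singleton_append, List.nodup_cons, List.toFinset_cons,
    List.isChain_singleton, true_and]
  rw [← List.mem_toFinset]
  constructor
  · rintro ⟨⟨h1, h2⟩, h3, h4⟩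
    obtain ⟨h5, h6⟩ := insert_helper.1 ⟨h1, h3⟩
    exact ⟨h5, h2, h6, h4⟩
  · rintro ⟨h5, h2, h6, h4⟩
    obtain ⟨h1, h3⟩ := insert_helper.2 ⟨h5, h6⟩
    exact ⟨⟨h1, h2⟩, h3, h4⟩

/-- Splitting off the last vertex of the first path. -/
theorem cover_concat_cons {S : Finset V} {a v : V} {l : List V} {PF : List (VSeq V)} :
    IsCoverOf G S ((a, l ++ [v]) :: PF) ↔
      v ∈ S ∧ G.Adj (VSeq.last (a, l)) v ∧ IsCoverOf G (S.erase v) ((a, l) :: PF) := by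
  unfold IsCoverOf
  simp only [List.map_cons, List.flatten_cons, List.forall_mem_cons]
  simp only [VSeq.verts, VSeq.last]
  rw [← List.cons_append, isChain_cons_append_singleton, List.append_assoc, List.singleton_append,
    List.nodup_middle, List.nodup_cons, List.toFinset_eq_of_perm _ _ List.perm_middle,
    List.toFinset_cons, ← List.mem_toFinset]
  constructor
  · rintro ⟨⟨h1, h2⟩, h3, ⟨h4, h4'⟩, h5⟩
    obtain ⟨h6, h7⟩ := insert_helper.1 ⟨h1, h3⟩
    exact ⟨h6, h4', h2, h7, h4, h5⟩
  · rintro ⟨h6, h4', h2, h7, h4, h5⟩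
    obtain ⟨h1, h3⟩ := insert_helper.2 ⟨h6, h7⟩
    exact ⟨⟨h1, h2⟩, h3, ⟨h4, h4'⟩, h5⟩

end CoverLemmas

/-! ### Cut vectors and end slots of `[]` and of `p :: PF` -/

section CutLemmas

variable {V : Type*} {g : ℕ} (lab : V → ℕ)

/-- The empty family is consistent with every cut: its cut vector is `𝟙`. -/
theorem uF_nil : (uF lab ([] : List (VSeq V)) : Vec g) = fun _ => 1 := by
  funext S
  simp [uF, consF]

/-- Consing a path with end ranks `i, j < g` multiplies the cut vector by the mask of `(i, j)`. -/
theorem uF_cons (p : VSeq V) (PF : List (VSeq V)) (i j : Fin g) (hi : (i : ℕ) = lab p.first)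
    (hj : (j : ℕ) = lab p.last) :
    (uF lab (p :: PF) : Vec g) = mulLin (maskVec i j) (uF lab PF) := by
  funext S
  have key : ∀ (k : Fin g) (n : ℕ), (k : ℕ) = n →
      ((∃ i' : Fin g, S i' = true ∧ (i' : ℕ) = n) ↔ S k = true) := by
    rintro k n rfl
    constructor
    · rintro ⟨i', h1, h2⟩
      rwa [Fin.ext h2] at h1
    · exact fun h => ⟨k, h, rfl⟩
  have hc : consF lab (p :: PF) S ↔ (S i = S j ∧ consF lab PF S) := by
    simp only [consF, List.forall_mem_cons, key i _ hi, key j _ hj, Bool.coe_iff_coe]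
  simp only [uF, mulLin, maskVec, LinearMap.coe_mk, AddHom.coe_mk]
  by_cases h1 : S i = S j <;> by_cases h2 : consF lab PF S <;> simp [hc, h1, h2]

/-- The empty family has no end slots. -/
theorem fSlots_nil (n : ℕ) : fSlots lab ([] : List (VSeq V)) n = 0 := by
  simp [fSlots]

/-- End slots of `p :: PF` at the ranks `t < g`, when the end ranks `i, j` of `p` are `< g`. -/
theorem fSlots_cons (p : VSeq V) (PF : List (VSeq V)) (i j : Fin g) (hi : (i : ℕ) = lab p.first)
    (hj : (j : ℕ) = lab p.last) (t : Fin g) :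
    fSlots lab (p :: PF) (t : ℕ) = fSlots lab PF (t : ℕ) + δ i t + δ j t := by
  have e1 : t = i ↔ lab p.first = (t : ℕ) := by rw [← hi, Fin.ext_iff, eq_comm]
  have e2 : t = j ↔ lab p.last = (t : ℕ) := by rw [← hj, Fin.ext_iff, eq_comm]
  simp only [fSlots, List.countP_cons, δ, e1, e2]
  by_cases h1 : lab p.first = (t : ℕ) <;> by_cases h2 : lab p.last = (t : ℕ) <;>
    simp [h1, h2] <;> omega

end CutLemmas

/-! ### Ranks of free vertices are `< g(m)` -/

section Main

variable (m : ℕ) (x : Fin m × Fin m → Bool)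

/-- The rank of a free vertex is the value of an index `i : Fin g(m)`: its class is present and
not counted by `rankOf`, and there are at most `|F| ≤ g(m)` classes. -/
theorem exists_fin_eq_rk {u : Fin m} (hu : u ∈ freeSet m) :
    ∃ i : Fin (gOf m), (i : ℕ) = rk m x u := by
  refine ⟨⟨rk m x u, ?_⟩, rfl⟩
  have hge : ∀ v ∈ freeSet m, m ≤ (v : ℕ) + gOf m := fun v hv => by
    simpa [freeSet, IsAnch] using hv
  have hF : (freeSet m).card ≤ (range (gOf m)).card :=
    card_le_card_of_injOn (fun v => (v : ℕ) + gOf m - m)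
      (fun v hv => by have := hge v hv; have := v.isLt; simp only [coe_range, Set.mem_Iio]; omega)
      (fun v hv w hw h => Fin.ext (by have := hge v hv; have := hge w hw; dsimp only at h; omega))
  rw [card_range] at hF
  unfold rk rankOf
  calc ((classes m x).filter fun N' => key m N' < key m (cls m x u)).card
      < (classes m x).card := card_lt_card (filter_ssubset.2 ⟨_, mem_image_of_mem _ hu, lt_irrefl _⟩)
    _ ≤ (freeSet m).card := card_image_le
    _ ≤ gOf m := hF

/-! ### The states of the recursion versus genuine (partial) covers -/

/-- Open step, generators: if the closed / open states over `P.erase v` contain the cut vectors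
of the corresponding configurations, so do the open states over `P`. -/
theorem gen_open_step (P : Finset (Fin m))
    (IHC : ∀ v ∈ P, ∀ (e : Fin (gOf m) → ℕ) (PF : List (VSeq (Fin m))),
      IsCoverOf (Gr m x) (P.erase v) PF → (∀ t : Fin (gOf m), fSlots (rk m x) PF (t : ℕ) = e t) →
      uF (rk m x) PF ∈ Cspan m x (P.erase v) e)
    (IHO : ∀ v ∈ P, ∀ (w : Fin m) (i : Fin (gOf m)) (e : Fin (gOf m) → ℕ) (p : VSeq (Fin m))
      (PF : List (VSeq (Fin m))), IsCoverOf (Gr m x) (P.erase v) (p :: PF) → p.last = w →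
      rk m x p.first = (i : ℕ) → (∀ t : Fin (gOf m), fSlots (rk m x) PF (t : ℕ) = e t) →
      uF (rk m x) PF ∈ Ospan m x (P.erase v) w i e)
    (v : Fin m) (i : Fin (gOf m)) (e : Fin (gOf m) → ℕ) (p : VSeq (Fin m))
    (PF : List (VSeq (Fin m))) (hcov : IsCoverOf (Gr m x) P (p :: PF)) (hlast : p.last = v)
    (hfirst : rk m x p.first = (i : ℕ)) (he : ∀ t : Fin (gOf m), fSlots (rk m x) PF (t : ℕ) = e t) :
    uF (rk m x) PF ∈ Ospan m x P v i e := by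
  obtain ⟨a, l⟩ := p
  rcases List.eq_nil_or_concat l with rfl | ⟨l', b, rfl⟩
  · change a = v at hlast
    subst hlast
    obtain ⟨hv, hcov'⟩ := cover_single_cons.1 hcov
    rw [Ospan_eq, if_pos hv, if_pos (show rk m x a = i from hfirst)]
    exact Submodule.mem_sup_left (IHC _ hv e PF hcov' he)
  · simp only [List.concat_eq_append] at hcov hlast
    rw [last_mk_concat] at hlast
    subst hlast
    obtain ⟨hv, hadj, hcov'⟩ := cover_concat_cons.1 hcov
    have hw : VSeq.last (a, l') ∈ P.erase b :=
      mem_of_cover hcov' (List.mem_cons_self ..) (List.getLast_mem _)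
    rw [Ospan_eq, if_pos hv]
    refine Submodule.mem_sup_right ?_
    refine Submodule.mem_iSup_of_mem (VSeq.last (a, l')) (Submodule.mem_iSup_of_mem hw ?_)
    rw [if_pos hadj]
    exact IHO _ hv _ i e (a, l') PF hcov' rfl hfirst he

/-- Closed step, generators: if the open states over `P ⊆ F` contain the cut vectors of the
open configurations, the closed states over `P` contain the cut vectors of the covers. -/
theorem gen_closed_step (P : Finset (Fin m)) (hP : P ⊆ freeSet m)
    (hO : ∀ (v : Fin m) (i : Fin (gOf m)) (e : Fin (gOf m) → ℕ) (p : VSeq (Fin m))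
      (PF : List (VSeq (Fin m))), IsCoverOf (Gr m x) P (p :: PF) → p.last = v →
      rk m x p.first = (i : ℕ) → (∀ t : Fin (gOf m), fSlots (rk m x) PF (t : ℕ) = e t) →
      uF (rk m x) PF ∈ Ospan m x P v i e)
    (e : Fin (gOf m) → ℕ) (PF : List (VSeq (Fin m))) (hcov : IsCoverOf (Gr m x) P PF)
    (he : ∀ t : Fin (gOf m), fSlots (rk m x) PF (t : ℕ) = e t) :
    uF (rk m x) PF ∈ Cspan m x P e := by
  rcases P.eq_empty_or_nonempty with rfl | hne
  · obtain rfl := cover_empty_eq_nil hcov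
    have he0 : e = 0 := funext fun t => by rw [← he t, fSlots_nil]; rfl
    rw [Cspan_empty, if_pos he0, uF_nil]
    exact Submodule.mem_span_singleton_self _
  · cases PF with
    | nil => obtain ⟨-, h2, -⟩ := hcov; simp at h2; exact absurd h2.symm hne.ne_empty
    | cons p PF =>
    have hpf : p.first ∈ P := mem_of_cover hcov (List.mem_cons_self ..) (List.mem_cons_self ..)
    have hpl : p.last ∈ P := mem_of_cover hcov (List.mem_cons_self ..) (List.getLast_mem _)
    obtain ⟨i, hi⟩ := exists_fin_eq_rk m x (hP hpf)
    obtain ⟨j, hj⟩ := exists_fin_eq_rk m x (hP hpl)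
    have he' : ∀ t : Fin (gOf m), fSlots (rk m x) PF (t : ℕ) + δ i t + δ j t = e t := fun t => by
      rw [← fSlots_cons (rk m x) p PF i j hi hj t]
      exact he t
    have hle : δ i + δ j ≤ e := fun t => by
      show δ i t + δ j t ≤ e t
      rw [← he' t]
      omega
    rw [Cspan_eq m x hne]
    refine Submodule.mem_iSup_of_mem p.last (Submodule.mem_iSup_of_mem hpl
      (Submodule.mem_iSup_of_mem i (Submodule.mem_iSup_of_mem j ?_)))
    rw [if_pos ⟨hj.symm, hle⟩, uF_cons (rk m x) p PF i j hi hj]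
    refine Submodule.mem_map_of_mem (hO p.last i _ p PF hcov rfl hi.symm fun t => ?_)
    rw [Pi.sub_apply, Pi.sub_apply, ← he' t]
    omega

/-- **Generators**: for `P ⊆ F`, the open (closed) state of the recursion at `P` contains the
cut vector of (the closed paths of) every open configuration (every cover) of `G[P]` with the
prescribed end vertex, first rank and margins. -/
theorem gen_mem (P : Finset (Fin m)) (hP : P ⊆ freeSet m) :
    (∀ (v : Fin m) (i : Fin (gOf m)) (e : Fin (gOf m) → ℕ) (p : VSeq (Fin m))
      (PF : List (VSeq (Fin m))), IsCoverOf (Gr m x) P (p :: PF) → p.last = v →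
      rk m x p.first = (i : ℕ) → (∀ t : Fin (gOf m), fSlots (rk m x) PF (t : ℕ) = e t) →
      uF (rk m x) PF ∈ Ospan m x P v i e) ∧
    (∀ (e : Fin (gOf m) → ℕ) (PF : List (VSeq (Fin m))), IsCoverOf (Gr m x) P PF →
      (∀ t : Fin (gOf m), fSlots (rk m x) PF (t : ℕ) = e t) → uF (rk m x) PF ∈ Cspan m x P e) := by
  induction P using Finset.strongInduction with
  | H P ih =>
    have hO := gen_open_step m x P
      (fun v hv => (ih _ (erase_ssubset hv) ((erase_subset v P).trans hP)).2)
      (fun v hv => (ih _ (erase_ssubset hv) ((erase_subset v P).trans hP)).1)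
    exact ⟨hO, gen_closed_step m x P hP hO⟩

/-- Open step, minimality: the open state over `P` lies in every subspace containing the cut
vectors of the open configurations, given the same for the states over `P.erase v`. -/
theorem min_open_step (P : Finset (Fin m))
    (IHC : ∀ v ∈ P, ∀ (e : Fin (gOf m) → ℕ) (Q : Submodule (ZMod 2) (Vec (gOf m))),
      (∀ PF : List (VSeq (Fin m)), IsCoverOf (Gr m x) (P.erase v) PF →
        (∀ t : Fin (gOf m), fSlots (rk m x) PF (t : ℕ) = e t) → uF (rk m x) PF ∈ Q) →
      Cspan m x (P.erase v) e ≤ Q)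
    (IHO : ∀ v ∈ P, ∀ (w : Fin m) (i : Fin (gOf m)) (e : Fin (gOf m) → ℕ)
      (Q : Submodule (ZMod 2) (Vec (gOf m))),
      (∀ (p : VSeq (Fin m)) (PF : List (VSeq (Fin m))), IsCoverOf (Gr m x) (P.erase v) (p :: PF) →
        p.last = w → rk m x p.first = (i : ℕ) →
        (∀ t : Fin (gOf m), fSlots (rk m x) PF (t : ℕ) = e t) → uF (rk m x) PF ∈ Q) →
      Ospan m x (P.erase v) w i e ≤ Q)
    (v : Fin m) (i : Fin (gOf m)) (e : Fin (gOf m) → ℕ) (Q : Submodule (ZMod 2) (Vec (gOf m)))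
    (hQ : ∀ (p : VSeq (Fin m)) (PF : List (VSeq (Fin m))), IsCoverOf (Gr m x) P (p :: PF) →
      p.last = v → rk m x p.first = (i : ℕ) →
      (∀ t : Fin (gOf m), fSlots (rk m x) PF (t : ℕ) = e t) → uF (rk m x) PF ∈ Q) :
    Ospan m x P v i e ≤ Q := by
  rw [Ospan_eq]
  by_cases hv : v ∈ P
  · rw [if_pos hv]
    refine sup_le ?_ (iSup₂_le fun w _ => ?_)
    · split_ifs with hrk
      · exact IHC v hv e Q fun PF hcov he =>
          hQ (v, []) PF (cover_single_cons.2 ⟨hv, hcov⟩) rfl hrk he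
      · exact bot_le
    · split_ifs with hadj
      · refine IHO v hv w i e Q fun p PF hcov hlast hfirst he => ?_
        obtain ⟨a, l⟩ := p
        subst hlast
        exact hQ (a, l ++ [v]) PF (cover_concat_cons.2 ⟨hv, hadj, hcov⟩) (last_mk_concat _ _ _)
          hfirst he
      · exact bot_le
  · rw [if_neg hv]
    exact bot_le

/-- Closed step, minimality: the closed state over `P` lies in every subspace containing the cut
vectors of the covers, given the same for the open states over `P`. -/
theorem min_closed_step (P : Finset (Fin m))
    (hO : ∀ (v : Fin m) (i : Fin (gOf m)) (e : Fin (gOf m) → ℕ)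
      (Q : Submodule (ZMod 2) (Vec (gOf m))),
      (∀ (p : VSeq (Fin m)) (PF : List (VSeq (Fin m))), IsCoverOf (Gr m x) P (p :: PF) →
        p.last = v → rk m x p.first = (i : ℕ) →
        (∀ t : Fin (gOf m), fSlots (rk m x) PF (t : ℕ) = e t) → uF (rk m x) PF ∈ Q) →
      Ospan m x P v i e ≤ Q)
    (e : Fin (gOf m) → ℕ) (Q : Submodule (ZMod 2) (Vec (gOf m)))
    (hQ : ∀ PF : List (VSeq (Fin m)), IsCoverOf (Gr m x) P PF →
      (∀ t : Fin (gOf m), fSlots (rk m x) PF (t : ℕ) = e t) → uF (rk m x) PF ∈ Q) :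
    Cspan m x P e ≤ Q := by
  rcases P.eq_empty_or_nonempty with rfl | hne
  · rw [Cspan_empty]
    split_ifs with he
    · subst he
      rw [Submodule.span_singleton_le_iff_mem, ← uF_nil (rk m x)]
      exact hQ [] (by simp [IsCoverOf]) fun t => by rw [fSlots_nil]; rfl
    · exact bot_le
  · rw [Cspan_eq m x hne]
    refine iSup₂_le fun v _ => iSup_le fun i => iSup_le fun j => ?_
    split_ifs with h
    · obtain ⟨hrk, hle⟩ := h
      rw [maskSub, Submodule.map_le_iff_le_comap]
      refine hO v i _ _ fun p PF hcov hlast hfirst he => ?_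
      have hj : (j : ℕ) = rk m x p.last := by rw [hlast]; exact hrk.symm
      rw [Submodule.mem_comap, ← uF_cons (rk m x) p PF i j hfirst.symm hj]
      refine hQ (p :: PF) hcov fun t => ?_
      rw [fSlots_cons (rk m x) p PF i j hfirst.symm hj, he t, Pi.sub_apply, Pi.sub_apply]
      have hle' : δ i t + δ j t ≤ e t := hle t
      omega
    · exact bot_le

/-- **Minimality**: the open (closed) state of the recursion at `P` lies in every subspace that
contains the cut vectors of (the closed paths of) all open configurations (all covers) of `G[P]`
with the prescribed end vertex, first rank and margins. -/
theorem min_le (P : Finset (Fin m)) :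
    (∀ (v : Fin m) (i : Fin (gOf m)) (e : Fin (gOf m) → ℕ) (Q : Submodule (ZMod 2) (Vec (gOf m))),
      (∀ (p : VSeq (Fin m)) (PF : List (VSeq (Fin m))), IsCoverOf (Gr m x) P (p :: PF) →
        p.last = v → rk m x p.first = (i : ℕ) →
        (∀ t : Fin (gOf m), fSlots (rk m x) PF (t : ℕ) = e t) → uF (rk m x) PF ∈ Q) →
      Ospan m x P v i e ≤ Q) ∧
    (∀ (e : Fin (gOf m) → ℕ) (Q : Submodule (ZMod 2) (Vec (gOf m))),
      (∀ PF : List (VSeq (Fin m)), IsCoverOf (Gr m x) P PF →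
        (∀ t : Fin (gOf m), fSlots (rk m x) PF (t : ℕ) = e t) → uF (rk m x) PF ∈ Q) →
      Cspan m x P e ≤ Q) := by
  induction P using Finset.strongInduction with
  | H P ih =>
    have hO := min_open_step m x P (fun v hv => (ih _ (erase_ssubset hv)).2)
      (fun v hv => (ih _ (erase_ssubset hv)).1)
    exact ⟨hO, min_closed_step m x P hO⟩

end Main

end SpanRecursion

/-- **stub_spanRecursion** (line `kotzig-cutspan`, crux `SymmetryBudget.HamCompiles`): the span
`W_F(d)` of the cut vectors of the path covers of `G[F]` with rank margins `d` is the closed state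
`Cspan F d` of the span-valued Held–Karp (vertex-growth) recursion. (≤) every cover's cut vector
lies in the closed state (`SpanRecursion.gen_mem`); (≥) every state is contained in the span of
the cut vectors of genuine covers (`SpanRecursion.min_le`). -/
theorem stub_spanRecursion (m : ℕ) (x : Fin m × Fin m → Bool) (d : Fin (gOf m) → ℕ) :
    WF m x d = Cspan m x (freeSet m) d := by
  apply le_antisymm
  · rw [WF, Submodule.span_le]
    rintro v ⟨PF, hcov, hd, rfl⟩
    exact (SpanRecursion.gen_mem m x (freeSet m) subset_rfl).2 d PF hcov hd
  · exact (SpanRecursion.min_le m x (freeSet m)).2 d (WF m x d) fun PF hcov hd =>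
      Submodule.subset_span ⟨PF, hcov, hd, rfl⟩

end Summit.PneNP.PneNP.Theorems.HamCompilesKC
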